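import Literature.AnabelianGeometry.AbsoluteAnabelian.AbsTopIII.BiAnabelianStarOverE

/-!
# [AbsTopIII] Cor. 3.7 — `K₀` is the identity on pairs through the reference model `𝒳`

[cite: MochizukiAbsTopIII2015, Cor 3.7 (i) p.87] [cite: MochizukiAbsTopIII2015, Cor 3.7 (iii) p.88]

abc-iut-L4-t5 (gen 5), row «COR37-COMPAT-LITERAL», sequel of `BiAnabelianStarOverE.lean` (p445994): the
universal family `K₀ = coresFamily` of homotopies on `𝒟*` over `𝔈` through the core vertex `𝔈` assigns to a
pair `([σ]∘[γ₁], [σ]∘[γ₂])` with `γ₁, γ₂` co-verticial into the core vertex `𝒳` and a common tail `σ : 𝒳 ⇝ 𝔈`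
the IDENTITY homotopy (`eqToHom` of the on-the-nose equality of functors `pathFunctor_eq_of_target_ref`) —
because both augmentation isomorphisms over `𝔈` are the same canonical one (`overE_pathIso_hom_app_eq_of_target_ref`)
and the structure functor at `𝔈` is the identity. This is the agreement, on their common pairs, of `K₀` with
(the whiskerings of) the identity homotopies of the `𝒳`-core of Cor. 3.7 (i) (abc-iut-L4-t9's `refCoreFamily`):
the cross condition that lets ONE family realise the `𝒳`-core and the `𝔈`-cores (Cor. 3.7 (iii), second clause,
`RealisesCoresAndLogObs`; plan HOME/staging/L4/L4-t5/DISCHARGE-PLAN-Cor37-compat.md). Proof-only; model-level;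
nothing here bears on [IUTchIII] Cor. 3.12.
-/

set_option autoImplicit false

namespace Literature.AnabelianGeometry.AbsoluteAnabelian.AbsTopIII

open CategoryTheory Quiver
open Literature.AnabelianGeometry.AbsoluteAnabelian.DiagramOfCategories

universe u

namespace BiAnabelianSetting

variable {X E N : Type u} [Category.{u} X] [Category.{u} E] [Category.{u} N]
  (𝔖 : BiAnabelianSetting X E N)

/-- Two paths `[σ]∘[γ₁]`, `[σ]∘[γ₂]` with `γ₁, γ₂` co-verticial into `𝒳` have THE SAME functor.
[cite: MochizukiAbsTopIII2015, Cor 3.7 (i) p.87] -/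
theorem pathFunctor_comp_eq_of_through_ref {a c : Cor37Vertex} (p q : Path a .ref) (s : Path Cor37Vertex.ref c) :
    𝔖.starDiagram.pathFunctor (p.comp s) = 𝔖.starDiagram.pathFunctor (q.comp s) := by
  rw [pathFunctor_comp, pathFunctor_comp, 𝔖.pathFunctor_eq_of_target_ref p q]

/-- Along `[σ]∘[γ₁]` and `[σ]∘[γ₂]` (`γ₁, γ₂` co-verticial into `𝒳`) the augmentation isomorphisms over `𝔈`
AGREE (up to the `eqToHom` of `pathFunctor_comp_eq_of_through_ref`). [cite: MochizukiAbsTopIII2015, Cor 3.7 (i) p.87] -/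
theorem overE_pathIso_hom_app_comp_eq_of_through_ref {a c : Cor37Vertex} (p q : Path a .ref)
    (s : Path Cor37Vertex.ref c) (x : 𝔖.starDiagram.obj a) :
    (𝔖.overE.pathIso (p.comp s)).hom.app x =
      eqToHom (congrArg (𝔖.overE.N c).obj
        (Functor.congr_obj (𝔖.pathFunctor_comp_eq_of_through_ref p q s) x)) ≫
        (𝔖.overE.pathIso (q.comp s)).hom.app x := by
  rw [OverData.pathIso_comp_app, OverData.pathIso_comp_app, 𝔖.overE_pathIso_hom_app_eq_of_target_ref p q x,
    NatTrans.congr (𝔖.overE.pathIso s).hom (Functor.congr_obj (𝔖.pathFunctor_eq_of_target_ref p q) x),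
    eqToHom_map, eqToHom_map]
  repeat erw [Category.assoc]
  repeat erw [eqToHom_trans_assoc]
  repeat erw [eqToHom_refl]
  repeat erw [Category.id_comp]
  rfl

/-- **`K₀` is the identity on pairs through `𝒳`.** For `γ₁, γ₂ : a ⇉ 𝒳` co-verticial and a common tail
`σ : 𝒳 ⇝ 𝔈`, the homotopy of the universal family `K₀` over `𝔈` at the pair `([σ]∘[γ₁], [σ]∘[γ₂])` is the
identity (`eqToHom`): the identity homotopies of the `𝒳`-core (Cor. 3.7 (i)), whiskered into `𝔈`, ARE the
homotopies of the `𝔈`-core family — the two core structures are compatible on their common pairs.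
[cite: MochizukiAbsTopIII2015, Cor 3.7 (iii) p.88] -/
theorem coresFamily_η_eq_eqToHom_of_through_ref {a : Cor37Vertex} (p q : Path a .ref)
    (s : Path Cor37Vertex.ref .galois) (h : 𝔖.coresFamily.E (p.comp s) (q.comp s)) :
    𝔖.coresFamily.η h = eqToHom (𝔖.pathFunctor_comp_eq_of_through_ref p q s) := by
  have hw : galoisVertex Cor37Vertex.galois := rfl
  refine (univFamily_η_eq_lift 𝔖.overE galoisVertex 𝔖.galoisVertex_fullyFaithful hw
    (p.comp s) (q.comp s) h).trans (OverData.lift_ext _ _ _ fun x => ?_).symm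
  rw [eqToHom_app, eqToHom_map, ← Iso.app_inv]
  refine (Iso.eq_comp_inv _).mpr ?_
  rw [Iso.app_hom, 𝔖.overE_pathIso_hom_app_comp_eq_of_through_ref p q s x]

end BiAnabelianSetting

end Literature.AnabelianGeometry.AbsoluteAnabelian.AbsTopIII
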